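import Mathlib
import Summits.AtomisticToContinuum.Crystallization.Theorems.ChessboardParticlePlanesLjLaminarWindowsSlabCount
import HarnessLib

/-! # Thick-circle count, part A (frames and the per-cell box bound) — stub `stub_thickCircle` of line
`Sketch` (skeleton rev. 14, lead c8), crux `LjLaminarWindows` (stmt-AtomisticToContinuum-6711) -/

noncomputable section

open scoped BigOperators
open Filter Topology
open scoped InnerProductSpace
open Literature.MathematicalPhysics.StatisticalMechanics
open Summit.AtomisticToContinuum.Crystallization.Theorems.ChargedEnergyGapNegative

namespace Summit.AtomisticToContinuum.Crystallization.Theorems.LjLaminarWindowsSketch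

/-- **Rotating a Parseval frame.** If `(e, n, g)` satisfies Parseval's identity on `ℝ³`, so does
`(e, cos ψ n + sin ψ g, -sin ψ n + cos ψ g)`. [folklore] -/
theorem thickCircle_parseval_rotate (e n g : E3)
    (hP : ∀ w : E3, ⟪w, e⟫_ℝ ^ 2 + ⟪w, n⟫_ℝ ^ 2 + ⟪w, g⟫_ℝ ^ 2 = ‖w‖ ^ 2) (ψ : ℝ) (w : E3) :
    ⟪w, e⟫_ℝ ^ 2 + ⟪w, Real.cos ψ • n + Real.sin ψ • g⟫_ℝ ^ 2 +
      ⟪w, -Real.sin ψ • n + Real.cos ψ • g⟫_ℝ ^ 2 = ‖w‖ ^ 2 := by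
  simp only [inner_add_right, real_inner_smul_right]
  linear_combination hP w + (⟪w, n⟫_ℝ ^ 2 + ⟪w, g⟫_ℝ ^ 2) * Real.sin_sq_add_cos_sq ψ

/-- **Polar form of rotated planar coordinates.** With `ρ = ‖S + iΣ‖` and `φ = arg (S + iΣ)`:
`cos ψ S + sin ψ Σ = ρ cos (φ - ψ)` and `-sin ψ S + cos ψ Σ = ρ sin (φ - ψ)`. [folklore] -/
theorem thickCircle_polar (S T ψ : ℝ) :
    Real.cos ψ * S + Real.sin ψ * T =
        ‖(⟨S, T⟩ : ℂ)‖ * Real.cos (Complex.arg ⟨S, T⟩ - ψ) ∧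
      -Real.sin ψ * S + Real.cos ψ * T =
        ‖(⟨S, T⟩ : ℂ)‖ * Real.sin (Complex.arg ⟨S, T⟩ - ψ) := by
  have hS := Complex.norm_mul_cos_arg ⟨S, T⟩
  have hT := Complex.norm_mul_sin_arg ⟨S, T⟩
  simp only at hS hT
  refine ⟨?_, ?_⟩
  · rw [Real.cos_sub]
    linear_combination -(Real.cos ψ * hS) - Real.sin ψ * hT
  · rw [Real.sin_sub]
    linear_combination Real.sin ψ * hS - Real.cos ψ * hT

/-- The squared norm of `S + iT` is `S² + T²`. [folklore] -/
theorem thickCircle_normSq (S T : ℝ) : ‖(⟨S, T⟩ : ℂ)‖ ^ 2 = S ^ 2 + T ^ 2 := by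
  rw [Complex.sq_norm, Complex.normSq_mk]
  ring

/-- **Axial coordinate from the two distances.** With `e = d⁻¹ (q' - q)`, `d = dist q q' > 0`:
`⟪y - q, e⟫ = (‖y - q‖² + d² - ‖y - q'‖²) / (2 d)`. [folklore] -/
theorem thickCircle_tcoord (q q' y : E3) (hd : 0 < dist q q') :
    ⟪y - q, (1 / dist q q') • (q' - q)⟫_ℝ =
      (dist y q ^ 2 + dist q q' ^ 2 - dist y q' ^ 2) / (2 * dist q q') := by
  have h1 : dist y q' = ‖(y - q) - (q' - q)‖ := by
    rw [dist_eq_norm]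
    congr 1
    abel
  have h2 : dist q q' = ‖q' - q‖ := by rw [dist_comm, dist_eq_norm]
  have h3 : dist y q = ‖y - q‖ := dist_eq_norm y q
  have hexp : ‖(y - q) - (q' - q)‖ ^ 2 =
      ‖y - q‖ ^ 2 - 2 * ⟪y - q, q' - q⟫_ℝ + ‖q' - q‖ ^ 2 := norm_sub_sq_real _ _
  rw [h1, h3, real_inner_smul_right, hexp, ← h2]
  field_simp
  ring

/-- **Basic constants.** For `1 ≤ R`, `100 R ≤ L` and `D = √(L R)`: `D² = L R`, `10 R ≤ D`,
`D ≤ L / 10`. [folklore] -/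
theorem thickCircle_D {L R : ℝ} (hR : 1 ≤ R) (hL : 100 * R ≤ L) :
    Real.sqrt (L * R) ^ 2 = L * R ∧ 10 * R ≤ Real.sqrt (L * R) ∧ Real.sqrt (L * R) ≤ L / 10 := by
  have hR0 : 0 < R := by linarith
  have hL0 : 0 < L := by linarith
  refine ⟨Real.sq_sqrt (by positivity), ?_, ?_⟩
  · calc 10 * R = Real.sqrt ((10 * R) ^ 2) := (Real.sqrt_sq (by linarith)).symm
      _ ≤ Real.sqrt (L * R) := Real.sqrt_le_sqrt (by nlinarith)
  · calc Real.sqrt (L * R) ≤ Real.sqrt ((L / 10) ^ 2) := Real.sqrt_le_sqrt (by nlinarith)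
      _ = L / 10 := Real.sqrt_sq (by linarith)


/-- **Per-point estimates in the tilted frame** (pure real arithmetic behind `thickCircle_cell`): with
`t² + s² + σ² = a²`, `a ∈ (L - R, L]`, `|t| ≤ 0.27 L`, `t ∈ [tl, tl + h]`, `s > 0`, `|σ| ≤ D/2`,
`t_c = tl + h/2`, `s_c = √(L² - t_c²)`: `|(-s_c t + t_c s)/L| ≤ 7(h + R)/10` and
`(t_c t + s_c s)/L ∈ [L - 3R/2, L]`. [folklore] -/
theorem thickCircle_point {L R D h tl tc sc a t s σ cθ sθ c₀ : ℝ} (hR : 1 ≤ R) (hL : 100 * R ≤ L)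
    (hDsq : D ^ 2 = L * R) (hD10 : 10 * R ≤ D) (hh : 0 < h) (hhD : h ≤ D)
    (htc : tc = tl + h / 2) (htc_abs : |tc| ≤ 8 / 25 * L) (hsc_sq : sc ^ 2 = L ^ 2 - tc ^ 2)
    (hsc0 : 0 ≤ sc) (hsc94 : 47 / 50 * L ≤ sc) (hscL : sc ≤ L)
    (hcθ : cθ = tc / L) (hsθ : sθ = sc / L) (hcs : cθ ^ 2 + sθ ^ 2 = 1) (hc₀ : c₀ = L - 3 / 4 * R)
    (H : t ^ 2 + s ^ 2 + σ ^ 2 = a ^ 2) (ha0 : 0 ≤ a) (ha1 : L - R < a) (ha2 : a ≤ L)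
    (htabs : |t| ≤ 27 / 100 * L) (ht1 : tl ≤ t) (ht2 : t ≤ tl + h) (hs0 : 0 < s) (hσ : |σ| ≤ D / 2) :
    |-sθ * t + cθ * s| ≤ 7 / 10 * h + 7 / 10 * R ∧ |σ| ≤ D / 2 ∧
      |cθ * t + sθ * s - c₀| ≤ 3 / 4 * R := by
  have hR0 : 0 < R := by linarith
  have hL0 : 0 < L := by linarith
  -- common facts
  have hσ2 : σ ^ 2 ≤ L * R / 4 := by
    have h1 : σ ^ 2 ≤ (D / 2) ^ 2 := by
      rw [← sq_abs]
      exact pow_le_pow_left₀ (abs_nonneg _) hσ 2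
    linarith [h1, hDsq]
  have ht2sq : t ^ 2 ≤ (27 / 100 * L) ^ 2 := by
    rw [← sq_abs]
    exact pow_le_pow_left₀ (abs_nonneg _) htabs 2
  have hLR99 : (99 / 100 * L) ^ 2 ≤ (L - R) ^ 2 :=
    pow_le_pow_left₀ (by positivity) (by linarith) 2
  have ha_sq : (L - R) ^ 2 < a ^ 2 := pow_lt_pow_left₀ ha1 (by linarith) two_ne_zero
  have hRL : 100 * R * R ≤ L * R := mul_le_mul_of_nonneg_right hL hR0.le
  -- `Y = L t - a t_c`
  have hY : |L * t - a * tc| ≤ L * (h / 2 + 8 / 25 * R) := by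
    have h1 : |t - tc| ≤ h / 2 := abs_le.mpr ⟨by linarith, by linarith⟩
    have h2 : |(L - a) * tc| ≤ R * (8 / 25 * L) := by
      rw [abs_mul, abs_of_nonneg (by linarith : 0 ≤ L - a)]
      exact mul_le_mul (by linarith) htc_abs (abs_nonneg _) hR0.le
    calc |L * t - a * tc| = |L * (t - tc) + (L - a) * tc| := by ring_nf
      _ ≤ |L * (t - tc)| + |(L - a) * tc| := abs_add_le _ _
      _ = L * |t - tc| + |(L - a) * tc| := by rw [abs_mul, abs_of_pos hL0]
      _ ≤ L * (h / 2) + R * (8 / 25 * L) := add_le_add (mul_le_mul_of_nonneg_left h1 hL0.le) h2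
      _ = L * (h / 2 + 8 / 25 * R) := by ring
  -- `X = L s - a s_c`
  have hXY : (L * s - a * sc) * (L * s + a * sc) =
      -((L * t - a * tc) * (L * t + a * tc)) - L ^ 2 * σ ^ 2 := by
    linear_combination L ^ 2 * H - a ^ 2 * hsc_sq
  have hpos : 93 / 100 * L ^ 2 ≤ L * s + a * sc := by
    have h1 : (L - R) * (47 / 50 * L) ≤ a * sc := mul_le_mul ha1.le hsc94 (by positivity) ha0
    linarith [h1, mul_pos hL0 hs0, mul_le_mul_of_nonneg_right hL hL0.le, mul_pos hR0 hL0]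
  have hZ : |L * t + a * tc| ≤ 59 / 100 * L ^ 2 := by
    calc |L * t + a * tc| ≤ |L * t| + |a * tc| := abs_add_le _ _
      _ = L * |t| + a * |tc| := by rw [abs_mul, abs_mul, abs_of_pos hL0, abs_of_nonneg ha0]
      _ ≤ L * (27 / 100 * L) + L * (8 / 25 * L) :=
          add_le_add (mul_le_mul_of_nonneg_left htabs hL0.le)
            (mul_le_mul ha2 htc_abs (abs_nonneg _) hL0.le)
      _ = 59 / 100 * L ^ 2 := by ring
  have hXabs : |L * s - a * sc| * (L * s + a * sc) ≤ L ^ 3 * (3 / 10 * h + 11 / 25 * R) := by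
    have e1 : |L * s - a * sc| * (L * s + a * sc) = |(L * s - a * sc) * (L * s + a * sc)| := by
      rw [abs_mul, abs_of_pos (by linarith [hpos, pow_pos hL0 2] : 0 < L * s + a * sc)]
    rw [e1, hXY]
    calc |-((L * t - a * tc) * (L * t + a * tc)) - L ^ 2 * σ ^ 2|
        ≤ |-((L * t - a * tc) * (L * t + a * tc))| + |L ^ 2 * σ ^ 2| := abs_sub _ _
      _ = |L * t - a * tc| * |L * t + a * tc| + L ^ 2 * σ ^ 2 := by
          rw [abs_neg, abs_mul, abs_of_nonneg (by positivity : 0 ≤ L ^ 2 * σ ^ 2)]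
      _ ≤ L * (h / 2 + 8 / 25 * R) * (59 / 100 * L ^ 2) + L ^ 2 * (L * R / 4) :=
          add_le_add (mul_le_mul hY hZ (abs_nonneg _) (by positivity))
            (mul_le_mul_of_nonneg_left hσ2 (by positivity))
      _ ≤ L ^ 3 * (3 / 10 * h + 11 / 25 * R) := by
          linarith [mul_pos (pow_pos hL0 3) hh, mul_pos (pow_pos hL0 3) hR0]
  have hXb : |L * s - a * sc| ≤ L * (1 / 3 * h + 1 / 2 * R) := by
    have h3 : |L * s - a * sc| * (93 / 100 * L ^ 2) ≤ L ^ 3 * (3 / 10 * h + 11 / 25 * R) :=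
      (mul_le_mul_of_nonneg_left hpos (abs_nonneg _)).trans hXabs
    by_contra hcon
    rw [not_le] at hcon
    have h4 := mul_lt_mul_of_pos_right hcon (by positivity : (0 : ℝ) < 93 / 100 * L ^ 2)
    linarith [h3, h4, mul_pos (pow_pos hL0 3) hh, mul_pos (pow_pos hL0 3) hR0]
  -- the `f`-coordinate
  have hF : |-sθ * t + cθ * s| ≤ 7 / 10 * h + 7 / 10 * R := by
    have hFid : (-sθ * t + cθ * s) * L ^ 2 = tc * (L * s - a * sc) - sc * (L * t - a * tc) := by
      rw [hcθ, hsθ]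
      field_simp
      ring
    have hF2 : |-sθ * t + cθ * s| * L ^ 2 ≤ (7 / 10 * h + 7 / 10 * R) * L ^ 2 := by
      have e1 : |-sθ * t + cθ * s| * L ^ 2 = |tc * (L * s - a * sc) - sc * (L * t - a * tc)| := by
        rw [← hFid, abs_mul, abs_of_pos (by positivity : (0 : ℝ) < L ^ 2)]
      rw [e1]
      calc |tc * (L * s - a * sc) - sc * (L * t - a * tc)|
          ≤ |tc * (L * s - a * sc)| + |sc * (L * t - a * tc)| := abs_sub _ _
        _ = |tc| * |L * s - a * sc| + sc * |L * t - a * tc| := by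
            rw [abs_mul, abs_mul, abs_of_nonneg hsc0]
        _ ≤ 8 / 25 * L * (L * (1 / 3 * h + 1 / 2 * R)) + L * (L * (h / 2 + 8 / 25 * R)) :=
            add_le_add (mul_le_mul htc_abs hXb (abs_nonneg _) (by positivity))
              (mul_le_mul hscL hY (abs_nonneg _) hL0.le)
        _ ≤ (7 / 10 * h + 7 / 10 * R) * L ^ 2 := by
            linarith [mul_pos (pow_pos hL0 2) hh, mul_pos (pow_pos hL0 2) hR0]
    exact le_of_mul_le_mul_right hF2 (by positivity)
  refine ⟨hF, hσ, ?_⟩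
  -- the `u`-coordinate
  have hUF : (cθ * t + sθ * s) ^ 2 + (-sθ * t + cθ * s) ^ 2 = t ^ 2 + s ^ 2 := by
    linear_combination (t ^ 2 + s ^ 2) * hcs
  have hF_sq : (-sθ * t + cθ * s) ^ 2 ≤ (77 / 100 * D) ^ 2 := by
    rw [← sq_abs]
    exact pow_le_pow_left₀ (abs_nonneg _) (by linarith) 2
  have hU_sq_lb : (L - 3 / 2 * R) ^ 2 ≤ (cθ * t + sθ * s) ^ 2 := by
    linarith [H, hUF, hF_sq, hσ2, ha_sq, hDsq, hRL, mul_pos hL0 hR0]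
  have hs95 : 19 / 20 * L ≤ s := by
    have hs2 : (19 / 20 * L) ^ 2 ≤ s ^ 2 := by
      linarith [H, ht2sq, hσ2, ha_sq, hLR99, mul_le_mul_of_nonneg_left hL hL0.le, pow_pos hL0 2]
    exact (pow_le_pow_iff_left₀ (by positivity) hs0.le two_ne_zero).mp hs2
  have hU_pos : 0 < cθ * t + sθ * s := by
    have htct : -(8 / 25 * L * (27 / 100 * L)) ≤ tc * t := by
      have h1 : |tc * t| ≤ 8 / 25 * L * (27 / 100 * L) := by
        rw [abs_mul]
        exact mul_le_mul htc_abs htabs (abs_nonneg _) (by positivity)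
      linarith [neg_abs_le (tc * t)]
    have hscs : 47 / 50 * L * (19 / 20 * L) ≤ sc * s := mul_le_mul hsc94 hs95 (by positivity) hsc0
    have hsum : 0 < tc * t + sc * s := by linarith [hscs, htct, pow_pos hL0 2]
    have e1 : cθ * t + sθ * s = (tc * t + sc * s) / L := by rw [hcθ, hsθ]; ring
    rw [e1]
    exact div_pos hsum hL0
  have hU_lb : L - 3 / 2 * R ≤ cθ * t + sθ * s :=
    (pow_le_pow_iff_left₀ (by linarith) hU_pos.le two_ne_zero).mp hU_sq_lb
  have hU_ub : cθ * t + sθ * s ≤ L := by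
    have h1 : (cθ * t + sθ * s) ^ 2 ≤ L ^ 2 := by
      have h2 : a ^ 2 ≤ L ^ 2 := pow_le_pow_left₀ ha0 ha2 2
      linarith [H, hUF, sq_nonneg σ, sq_nonneg (-sθ * t + cθ * s), h2]
    exact (pow_le_pow_iff_left₀ hU_pos.le hL0.le two_ne_zero).mp h1
  rw [hc₀, abs_le]
  constructor <;> linarith

/-- **Per-cell box count.** Let `(e, n, g)` be a Parseval frame of `ℝ³`, `1 ≤ R`, `100 R ≤ L`,
`D = √(L R)`, `0 < h ≤ D`.  The indices `p ∈ S` of a `7/10`-separated family whose points `x p` satisfy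
`L - R < ‖x p - q‖ ≤ L`, `|⟪x p - q, e⟫| ≤ 0.27 L`, `⟪x p - q, e⟫ ∈ [tl, tl + h]`, `0 < ⟪x p - q, n⟫`,
`|⟪x p - q, g⟫| ≤ D / 2` number at most `(7h/2 + 7R/2 + 1)(5D/2 + 1)(15R/4 + 1)`: in the orthonormal
frame `u = (t_c e + s_c n)/L`, `f = (-s_c e + t_c n)/L`, `g` (`t_c = tl + h/2`, `s_c = √(L² - t_c²)`)
the points lie in a box of half-widths `(7(h + R)/10, D/2, 3R/4)`, and `slabCount_card_le_prod`
applies. [folklore] -/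
theorem thickCircle_cell :
    ∀ {N : ℕ} (x : Fin N → E3), (∀ j k : Fin N, j ≠ k → (7 : ℝ) / 10 ≤ dist (x j) (x k)) →
      ∀ {L R h tl : ℝ}, 1 ≤ R → 100 * R ≤ L → 0 < h → h ≤ Real.sqrt (L * R) →
      ∀ (q e n g : E3),
        (∀ w : E3, inner ℝ w e ^ 2 + inner ℝ w n ^ 2 + inner ℝ w g ^ 2 = ‖w‖ ^ 2) →
      ∀ (S : Finset (Fin N)),
        (∀ p ∈ S, L - R < ‖x p - q‖ ∧ ‖x p - q‖ ≤ L ∧ |inner ℝ (x p - q) e| ≤ 27 / 100 * L ∧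
          tl ≤ inner ℝ (x p - q) e ∧ inner ℝ (x p - q) e ≤ tl + h ∧ 0 < inner ℝ (x p - q) n ∧
          |inner ℝ (x p - q) g| ≤ Real.sqrt (L * R) / 2) →
        (S.card : ℝ) ≤
          (7 / 2 * h + 7 / 2 * R + 1) * (5 / 2 * Real.sqrt (L * R) + 1) * (15 / 4 * R + 1) := by
  intro N x hsep L R h tl hR hL hh hhD q e n g hP S hS
  rcases S.eq_empty_or_nonempty with h0 | ⟨p₁, hp₁⟩
  · rw [h0, Finset.card_empty, Nat.cast_zero]
    have : 0 ≤ Real.sqrt (L * R) := Real.sqrt_nonneg _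
    positivity
  -- basic constants
  obtain ⟨hDsq, hD10, hDL⟩ := thickCircle_D hR hL
  set D := Real.sqrt (L * R) with hD
  have hR0 : 0 < R := by linarith
  have hL0 : 0 < L := by linarith
  -- centre of the row and the tilted frame
  obtain ⟨tc, htc⟩ : ∃ tc : ℝ, tc = tl + h / 2 := ⟨_, rfl⟩
  have htc_abs : |tc| ≤ 8 / 25 * L := by
    obtain ⟨-, -, ht, ht1, ht2, -, -⟩ := hS p₁ hp₁
    rw [abs_le] at ht ⊢
    constructor <;> linarith
  obtain ⟨sc, hsc⟩ : ∃ sc : ℝ, sc = Real.sqrt (L ^ 2 - tc ^ 2) := ⟨_, rfl⟩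
  have htc2 : tc ^ 2 ≤ (8 / 25 * L) ^ 2 := by
    rw [← sq_abs]
    exact pow_le_pow_left₀ (abs_nonneg _) htc_abs 2
  have hsc_sq : sc ^ 2 = L ^ 2 - tc ^ 2 := by rw [hsc]; exact Real.sq_sqrt (by nlinarith)
  have hsc0 : 0 ≤ sc := by rw [hsc]; exact Real.sqrt_nonneg _
  have hsc94 : 47 / 50 * L ≤ sc := by
    rw [hsc]
    calc 47 / 50 * L = Real.sqrt ((47 / 50 * L) ^ 2) := (Real.sqrt_sq (by linarith)).symm
      _ ≤ Real.sqrt (L ^ 2 - tc ^ 2) := Real.sqrt_le_sqrt (by nlinarith)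
  have hscL : sc ≤ L := by
    rw [hsc]
    calc Real.sqrt (L ^ 2 - tc ^ 2) ≤ Real.sqrt (L ^ 2) := Real.sqrt_le_sqrt (by nlinarith)
      _ = L := Real.sqrt_sq hL0.le
  obtain ⟨cθ, hcθ⟩ : ∃ c : ℝ, c = tc / L := ⟨_, rfl⟩
  obtain ⟨sθ, hsθ⟩ : ∃ c : ℝ, c = sc / L := ⟨_, rfl⟩
  have hcs : cθ ^ 2 + sθ ^ 2 = 1 := by
    rw [hcθ, hsθ]
    field_simp
    linarith [hsc_sq]
  obtain ⟨c₀, hc₀⟩ : ∃ c : ℝ, c = L - 3 / 4 * R := ⟨_, rfl⟩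
  -- per-point bounds in the tilted frame
  have hpt : ∀ p ∈ S,
      |-sθ * ⟪x p - q, e⟫_ℝ + cθ * ⟪x p - q, n⟫_ℝ| ≤ 7 / 10 * h + 7 / 10 * R ∧
      |⟪x p - q, g⟫_ℝ| ≤ D / 2 ∧
      |cθ * ⟪x p - q, e⟫_ℝ + sθ * ⟪x p - q, n⟫_ℝ - c₀| ≤ 3 / 4 * R := by
    intro p hp
    obtain ⟨ha1, ha2, htabs, ht1, ht2, hs0, hσ⟩ := hS p hp
    have H := hP (x p - q)
    have ha0 : 0 ≤ ‖x p - q‖ := norm_nonneg _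
    exact thickCircle_point hR hL hDsq hD10 hh hhD htc htc_abs hsc_sq hsc0 hsc94 hscL hcθ hsθ hcs hc₀
      H ha0 ha1 ha2 htabs ht1 ht2 hs0 hσ
  -- the coordinate map and its isometry property
  set v : Fin N → E3 := fun p => !₂[-sθ * ⟪x p - q, e⟫_ℝ + cθ * ⟪x p - q, n⟫_ℝ, ⟪x p - q, g⟫_ℝ,
    cθ * ⟪x p - q, e⟫_ℝ + sθ * ⟪x p - q, n⟫_ℝ - c₀] with hv
  have hv0 : ∀ p, v p 0 = -sθ * ⟪x p - q, e⟫_ℝ + cθ * ⟪x p - q, n⟫_ℝ := fun p => rfl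
  have hv1 : ∀ p, v p 1 = ⟪x p - q, g⟫_ℝ := fun p => rfl
  have hv2 : ∀ p, v p 2 = cθ * ⟪x p - q, e⟫_ℝ + sθ * ⟪x p - q, n⟫_ℝ - c₀ := fun p => rfl
  have hdist : ∀ p p' : Fin N, dist (v p) (v p') = dist (x p) (x p') := by
    intro p p'
    have hw : x p - x p' = (x p - q) - (x p' - q) := by abel
    have hPw := hP ((x p - q) - (x p' - q))
    have i1 : ⟪(x p - q) - (x p' - q), e⟫_ℝ = ⟪x p - q, e⟫_ℝ - ⟪x p' - q, e⟫_ℝ := inner_sub_left _ _ _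
    have i2 : ⟪(x p - q) - (x p' - q), n⟫_ℝ = ⟪x p - q, n⟫_ℝ - ⟪x p' - q, n⟫_ℝ := inner_sub_left _ _ _
    have i3 : ⟪(x p - q) - (x p' - q), g⟫_ℝ = ⟪x p - q, g⟫_ℝ - ⟪x p' - q, g⟫_ℝ := inner_sub_left _ _ _
    rw [i1, i2, i3, ← hw, ← dist_eq_norm] at hPw
    have hsum : dist (v p 0) (v p' 0) ^ 2 + dist (v p 1) (v p' 1) ^ 2 + dist (v p 2) (v p' 2) ^ 2 =
        dist (x p) (x p') ^ 2 := by
      rw [hv0, hv0, hv1, hv1, hv2, hv2, Real.dist_eq, Real.dist_eq, Real.dist_eq, sq_abs, sq_abs,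
        sq_abs, ← hPw]
      linear_combination (( ⟪x p - q, e⟫_ℝ - ⟪x p' - q, e⟫_ℝ) ^ 2 +
        (⟪x p - q, n⟫_ℝ - ⟪x p' - q, n⟫_ℝ) ^ 2) * hcs
    rw [EuclideanSpace.dist_eq, Fin.sum_univ_three, hsum, Real.sqrt_sq dist_nonneg]
  have hsepv : ∀ p ∈ S, ∀ p' ∈ S, p ≠ p' → (7 : ℝ) / 10 ≤ dist (v p) (v p') := by
    intro p _ p' _ hpp
    rw [hdist]
    exact hsep p p' hpp
  -- the box
  set c : Fin 3 → ℝ := ![7 / 10 * h + 7 / 10 * R, D / 2, 3 / 4 * R] with hc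
  have e0 : c 0 = 7 / 10 * h + 7 / 10 * R := rfl
  have e1 : c 1 = D / 2 := rfl
  have e2 : c 2 = 3 / 4 * R := rfl
  have hD0 : 0 ≤ D := by rw [hD]; exact Real.sqrt_nonneg _
  have hc0 : ∀ j, 0 ≤ c j := by
    intro j
    fin_cases j
    · show 0 ≤ c 0
      rw [e0]; positivity
    · show 0 ≤ c 1
      rw [e1]; positivity
    · show 0 ≤ c 2
      rw [e2]; positivity
  have hbox : ∀ p ∈ S, ∀ j, |v p j| ≤ c j := by
    intro p hp j
    obtain ⟨b0, b1, b2⟩ := hpt p hp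
    fin_cases j
    · show |v p 0| ≤ c 0
      rw [hv0, e0]; exact b0
    · show |v p 1| ≤ c 1
      rw [hv1, e1]; exact b1
    · show |v p 2| ≤ c 2
      rw [hv2, e2]; exact b2
  have key := slabCount_card_le_prod v S hsepv c hc0 hbox
  rw [Fin.prod_univ_three, e0, e1, e2] at key
  have r0 : 2 * (7 / 10 * h + 7 / 10 * R) / (2 / 5) + 1 = 7 / 2 * h + 7 / 2 * R + 1 := by ring
  have r1 : 2 * (D / 2) / (2 / 5) + 1 = 5 / 2 * D + 1 := by ring
  have r2 : 2 * (3 / 4 * R) / (2 / 5) + 1 = 15 / 4 * R + 1 := by ring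
  rw [r0, r1, r2] at key
  exact key

end Summit.AtomisticToContinuum.Crystallization.Theorems.LjLaminarWindowsSketch

end
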